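import Summits.QuantumFields.YangMills.Theorems.ColdStartUniversalityShenZhuZhuTalagrandLimitPointsSU2
import Summits.QuantumFields.YangMills.Theorems.ColdStartUniversalityUniformColdStartMixingOfLogSobolev
import HarnessLib

/-!
# THE DATA-PROCESSING INEQUALITY FOR THE RELATIVE ENTROPY, and TALAGRAND'S `T₂` FOR ALL WINDOWS OF AN INFINITE-VOLUME LIMIT POINT CONTROLLED BY THE
# FULL RELATIVE ENTROPY:  `W₂^(d_B)(ν_B, μ_B)² ≤ (2/(1−12|β'|))·KL(ν‖μ)` for every probability `ν` on `SU(2)^(E⁺(ℤ³))` and every finite `B`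

Seat `ym-line-csu-p1` (g43), route `ColdStartUniversality` of `Summits/QuantumFields/YangMills`, helper file (`--supports stmt-QuantumFields-24809`).
* ★★ `klDiv_map_le_klDiv` — GENERIC: for a measurable map `f : α → β` between standard Borel spaces and finite measures `ν, μ` on `α`,
  `KL(f_*ν ‖ f_*μ) ≤ KL(ν ‖ μ)` (graph embedding `x ↦ (f x, x)` preserves `KL`; disintegration `f_*ν ⊗ κ_ν`; Mathlib's chain rule
  `klDiv_compProd_eq_add`).  Not found in Mathlib in this form at the time of writing.
* ★★★★ `limitPoint_window_talagrand_of_klDiv` — for `μ ∈ infiniteVolumeLimitPoints (fundamentalRep (Fin 2)) β'`, `|β'| < 1/12`, every probability `ν` on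
  `SU(2)^(E⁺(ℤ³))` with `KL(ν‖μ) < ∞` and EVERY finite window `B`: the window marginals admit an optimal coupling with
  `∫ d_B² dπ ≤ (2/(1−12|β'|))·KL(ν‖μ)` — the same entropy bound for all windows at once (the `ρ_∞` statement short of a simultaneous coupling).
THEOREMS ONLY, no definition, no sorry.  HONEST FRAMING: fixed lattice, `|β'| < 1/12`; infinite-volume limit points of the torus states; nothing about
the continuum; no crux, rung or summit statement is proved; the Yang–Mills mass gap is NOT proved.
-/

set_option autoImplicit false

noncomputable section

namespace Summit.QuantumFields.YangMills.Theorems.ColdStartUniversality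

open MeasureTheory ProbabilityTheory Filter Topology Set Finset
open scoped BigOperators NNReal ENNReal
open Literature.MathematicalPhysics.QuantumFieldTheory
open Literature.MathematicalPhysics.QuantumLattice (fundamentalRep fundamentalLatticeRep continuous_fundamentalRep fundamentalRep_apply fundamentalLatticeRep_N
  IsCylinder infiniteVolumeLimitPoints IsInfiniteVolumeLimitAlong toTorusObservable)
open InformationTheory (klDiv)

/-! ## §1. Data processing for the relative entropy -/

/-- ★★ **Data-processing inequality for the Kullback–Leibler divergence** (standard Borel spaces, finite measures, measurable map):
`KL(f_*ν ‖ f_*μ) ≤ KL(ν ‖ μ)`.  Proof: `x ↦ (f x, x)` is a measurable embedding (`KL` is preserved), the image measures disintegrate over the first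
factor as `f_*ν ⊗ κ_ν`, `f_*μ ⊗ κ_μ`, and the chain rule `KL(f_*ν ⊗ κ_ν ‖ f_*μ ⊗ κ_μ) = KL(f_*ν‖f_*μ) + KL(f_*ν ⊗ κ_ν ‖ f_*ν ⊗ κ_μ)` drops a nonnegative term.
[folklore] -/
theorem klDiv_map_le_klDiv {α β : Type*} [MeasurableSpace α] [StandardBorelSpace α] [Nonempty α]
    [MeasurableSpace β] [StandardBorelSpace β]
    (ν μ : Measure α) [IsFiniteMeasure ν] [IsFiniteMeasure μ] {f : α → β} (hf : Measurable f) :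
    klDiv (ν.map f) (μ.map f) ≤ klDiv ν μ := by
  have hg : MeasurableEmbedding (fun x : α => (f x, x)) :=
    (hf.prodMk measurable_id).measurableEmbedding (fun x y h => (Prod.ext_iff.1 h).2)
  haveI : IsFiniteMeasure (ν.map fun x : α => (f x, x)) := Measure.isFiniteMeasure_map _ _
  haveI : IsFiniteMeasure (μ.map fun x : α => (f x, x)) := Measure.isFiniteMeasure_map _ _
  have h1 : klDiv (ν.map fun x : α => (f x, x)) (μ.map fun x : α => (f x, x)) = klDiv ν μ :=
    klDiv_map_eq_of_measurableEmbedding hg ν μ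
  have hfst_ν : (ν.map fun x : α => (f x, x)).fst = ν.map f := by
    rw [Measure.fst, Measure.map_map measurable_fst (hf.prodMk measurable_id')]; rfl
  have hfst_μ : (μ.map fun x : α => (f x, x)).fst = μ.map f := by
    rw [Measure.fst, Measure.map_map measurable_fst (hf.prodMk measurable_id')]; rfl
  have hdν : (ν.map f) ⊗ₘ (ν.map fun x : α => (f x, x)).condKernel = ν.map fun x : α => (f x, x) := by
    rw [← hfst_ν]; exact (ν.map fun x : α => (f x, x)).disintegrate _
  have hdμ : (μ.map f) ⊗ₘ (μ.map fun x : α => (f x, x)).condKernel = μ.map fun x : α => (f x, x) := by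
    rw [← hfst_μ]; exact (μ.map fun x : α => (f x, x)).disintegrate _
  haveI : IsFiniteMeasure (ν.map f) := Measure.isFiniteMeasure_map _ _
  haveI : IsFiniteMeasure (μ.map f) := Measure.isFiniteMeasure_map _ _
  calc klDiv (ν.map f) (μ.map f)
      ≤ klDiv (ν.map f) (μ.map f) + klDiv ((ν.map f) ⊗ₘ (ν.map fun x : α => (f x, x)).condKernel)
          ((ν.map f) ⊗ₘ (μ.map fun x : α => (f x, x)).condKernel) := le_self_add
    _ = klDiv ((ν.map f) ⊗ₘ (ν.map fun x : α => (f x, x)).condKernel) ((μ.map f) ⊗ₘ (μ.map fun x : α => (f x, x)).condKernel) :=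
        (InformationTheory.klDiv_compProd_eq_add _ _ _ _).symm
    _ = klDiv (ν.map fun x : α => (f x, x)) (μ.map fun x : α => (f x, x)) := by rw [hdν, hdμ]
    _ = klDiv ν μ := h1

/-! ## §2. Talagrand's inequality for all windows, controlled by the full relative entropy -/

/-- ★★★★ **`T₂` for every window of an infinite-volume limit point, with the FULL relative entropy.**  Let `|β'| < 1/12`, `μ` an infinite-volume limit point of
the torus Wilson states of three-dimensional `SU(2)` lattice Yang–Mills, and `ν` a probability measure on `SU(2)^(E⁺(ℤ³))` with `KL(ν‖μ) < ∞`.  Then for every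
finite window `B ⊆ E⁺(ℤ³)` (restriction `r_B`):  `szzWassersteinSq d_B² (r_B)_*ν (r_B)_*μ ≤ ofReal((2/(1−12|β'|))·KL(ν‖μ))` — one entropy bound for the optimal
window couplings of ALL windows (`limitPoint_window_talagrand` + data processing). [cite: BakryGentilLedoux2014, Thm 9.6.1] [cite: ShenZhuZhuCMP2023, Theorem 1.4] -/
theorem limitPoint_window_talagrand_of_klDiv {β' : ℝ} (hβ : |β'| < 1 / 12) {μ : Measure (Literature.MathematicalPhysics.QuantumLattice.LGConfig 3 (Matrix.specialUnitaryGroup (Fin 2) ℂ))}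
    (hμ : μ ∈ infiniteVolumeLimitPoints (d := 3) (fundamentalRep (Fin 2)) β')
    (ν : Measure (Literature.MathematicalPhysics.QuantumLattice.LGConfig 3 (Matrix.specialUnitaryGroup (Fin 2) ℂ))) [IsProbabilityMeasure ν] (hfin : klDiv ν μ ≠ ∞) (B : Finset (Literature.MathematicalPhysics.QuantumLattice.ZdEdge 3)) :
    szzWassersteinSq (fun u v : (↥B → Matrix.specialUnitaryGroup (Fin 2) ℂ) => (∑ i, (fundamentalLatticeRep 2).riemannDist (u i) (v i) ^ 2)) (ν.map (fun (x : Literature.MathematicalPhysics.QuantumLattice.LGConfig 3 (Matrix.specialUnitaryGroup (Fin 2) ℂ)) (b : ↥B) => x b.1)) (μ.map (fun (x : Literature.MathematicalPhysics.QuantumLattice.LGConfig 3 (Matrix.specialUnitaryGroup (Fin 2) ℂ)) (b : ↥B) => x b.1)) ≤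
      ENNReal.ofReal (2 * (1 / (1 - 12 * |β'|)) * (klDiv ν μ).toReal) := by
  classical
  haveI := secondCountableTopology_su2
  obtain ⟨Ls, hLs, hprob, hlim⟩ := hμ
  haveI := hprob
  have hμ' : μ ∈ infiniteVolumeLimitPoints (d := 3) (fundamentalRep (Fin 2)) β' := ⟨Ls, hLs, hprob, hlim⟩
  have hr : Measurable (fun (x : Literature.MathematicalPhysics.QuantumLattice.LGConfig 3 (Matrix.specialUnitaryGroup (Fin 2) ℂ)) (b : ↥B) => x b.1) := measurable_pi_lambda _ fun b => measurable_pi_apply _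
  haveI : IsProbabilityMeasure (ν.map (fun (x : Literature.MathematicalPhysics.QuantumLattice.LGConfig 3 (Matrix.specialUnitaryGroup (Fin 2) ℂ)) (b : ↥B) => x b.1)) := Measure.isProbabilityMeasure_map hr.aemeasurable
  have hdpi : klDiv (ν.map (fun (x : Literature.MathematicalPhysics.QuantumLattice.LGConfig 3 (Matrix.specialUnitaryGroup (Fin 2) ℂ)) (b : ↥B) => x b.1)) (μ.map (fun (x : Literature.MathematicalPhysics.QuantumLattice.LGConfig 3 (Matrix.specialUnitaryGroup (Fin 2) ℂ)) (b : ↥B) => x b.1)) ≤ klDiv ν μ := klDiv_map_le_klDiv ν μ hr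
  have hfinB : klDiv (ν.map (fun (x : Literature.MathematicalPhysics.QuantumLattice.LGConfig 3 (Matrix.specialUnitaryGroup (Fin 2) ℂ)) (b : ↥B) => x b.1)) (μ.map (fun (x : Literature.MathematicalPhysics.QuantumLattice.LGConfig 3 (Matrix.specialUnitaryGroup (Fin 2) ℂ)) (b : ↥B) => x b.1)) ≠ ∞ := ne_top_of_le_ne_top hfin hdpi
  have h12 : 0 < 1 - 12 * |β'| := by linarith
  refine (limitPoint_window_talagrand hβ hμ' B (ν.map (fun (x : Literature.MathematicalPhysics.QuantumLattice.LGConfig 3 (Matrix.specialUnitaryGroup (Fin 2) ℂ)) (b : ↥B) => x b.1)) hfinB).trans (ENNReal.ofReal_le_ofReal ?_)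
  exact mul_le_mul_of_nonneg_left (ENNReal.toReal_mono hfin hdpi) (by positivity)

end Summit.QuantumFields.YangMills.Theorems.ColdStartUniversality
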